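import Mathlib.Analysis.Calculus.ContDiff.Bounds
import Literature.Analysis.FunctionSpaces.TorusMollifier
import Literature.Analysis.FunctionSpaces.TorusConvolution
import Literature.Analysis.FunctionSpaces.HolderNormProofs
import HarnessLib

/-!
# Mollification on `T^d`: derivatives of all orders, with the derivatives on the kernel

Analysis/FunctionSpaces support file (serves the discharge of the mollification stage of the
Buckmaster–De Lellis–Székelyhidi–Vicol convex-integration scheme,
`Literature.Analysis.FluidPDE.BDSV.mollificationStage`, `FluidPDE/OnsagerBDSVThreeStages`: the
"standard mollification estimates" `‖v * ψ_ℓ‖_{N+1} ≲ ℓ^{-N} ‖v‖_1`,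
`‖R * ψ_ℓ‖_{N+α} ≲ ℓ^{-N-α} ‖R‖_0` of the proof of Prop. 2.2 of arXiv:1701.08678, for every
`N`). For the standard mollifier `k_ε = Torus.kernel ε` on the flat torus (`TorusMollifier`; the
mollification of a smooth `k : T^d → F` is `k_ε ⋆ k`, kernel on the left as in
`TorusConvolution`/`TorusSpaceTimeKernel`, so that joint space–time smoothness and the formulas
`D(θ ⋆ k) = θ ⋆ Dk`, `∂ₜ(θ ⋆ g) = θ ⋆ ∂ₜ g` of those files apply verbatim) we prove, in the
`C^{k,r}(T^d)` vocabulary of `HolderNorm` (derivatives = `iteratedFDeriv ℝ j (Torus.lift ·)`):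

* `Torus.itDeriv n f x = D^n (liftAt f x) 0` — the `n`-th derivative of `f : T^d → F` as a function
  on the torus, whose lift is `D^n (lift f)` (`Torus.iteratedFDeriv_lift_apply`), continuous/smooth
  for smooth `f`;
* `Torus.convolution_lineDeriv_right` — integration by parts inside a mollification, vector-valued:
  `ψ ⋆ ∂_v k = (∂_v ψ) ⋆ k` for smooth real `ψ` and smooth `k : T^d → F`;
* `Torus.norm_iteratedFDeriv_lift_convolution_le` — **all derivatives fall on the kernel**:
  `‖D^N (lift (ψ ⋆ k))(x)‖ ≤ ∫ ‖itDeriv N ψ (proj x - y)‖ ‖k y‖ dy` (induction on `N`);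
* `Torus.derivProfileMass d N = ∫ ‖D^N ρ₁‖` and the scaling
  `∫_{T^d} ‖itDeriv N (kernel ε)‖ = ε^{-N} c_N` (`Torus.integral_norm_itDeriv_kernel`), the
  derivatives of the kernel living in `{‖reprc z‖ ≤ ε}`;
* the sup bounds `‖D^N (lift (k_ε ⋆ k))(x)‖ ≤ c_N ε^{-N} sup_{B_ε(proj x)} ‖k‖` (local form,
  `Torus.norm_iteratedFDeriv_lift_kernel_convolution_le`), the global form, and
  `‖D^{N+1} (lift (k_ε ⋆ k))‖ ≤ c_N ε^{-N} ‖Dk‖_∞`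
  (`Torus.norm_iteratedFDeriv_succ_lift_kernel_convolution_le`);

Hölder seminorms of `D^N` and the `C^{N,r}(T^d)` norms (`Torus.eContDiffHolderNorm N r g`, which is
`eContDiffHolderNorm N r (lift g)`) are then obtained downstream from these sup bounds on
`D^N, D^{N+1}` by the tree's interpolation/packaging lemma
`Literature.Analysis.FunctionSpaces.eContDiffHolderNorm_le_of_norm_iteratedFDeriv_le`
(`HolderInterpolation.lean`, δ-form, used with `δ = ε`); nothing of that is repeated here.

## Mathlib / tree search

Mathlib (this pin) differentiates Euclidean convolutions once (`HasCompactSupport.hasFDerivAt_convolution_left/right`)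
and proves smoothness (`contDiff_convolution_…`) but has no formula or bound for *iterated*
derivatives of a convolution (searched `iteratedFDeriv` + `convolution`: none; the swapped form
`(ψ ⋆ k)(z) = ∫ ψ(z - y) • k(y)` is Mathlib's `convolution_lsmul_swap`). Nearest prior art in
the tree: `Literature.Analysis.Distribution.SmoothCutoff.iteratedFDeriv_convolution_right` /
`norm_iteratedFDeriv_convolution_right_le` (Euclidean, scalar, compactly supported smooth `ρ`,
derivatives on the right factor) — the present inequality is the torus / vector-valued /
general-smooth-kernel analogue, stated through `Torus.itDeriv` and `Torus.lift`. Mathlib has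
`iteratedFDeriv_comp_const_smul` (scaling), `norm_iteratedFDeriv_clm_apply_const`,
`iteratedFDeriv_clm_apply_const_apply`, `norm_iteratedFDeriv_fderiv`, all used here. Tree:
first-order versions of everything (`Torus.fderiv_lift_convolution`,
`Torus.integral_norm_gradient_kernel` with the constant `Torus.gradProfileMass d = derivProfileMass d 1`,
see `Torus.derivProfileMass_one`; `Torus.abs_partialDeriv_convolution_kernel_le`,
`Torus.convolution_partialDeriv_right`), `Torus.iteratedFDeriv_lift` (`HolderNormProofs`), on
which `Torus.itDeriv` is built, and the Hölder packaging of `HolderInterpolation.lean`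
(`eSupNorm_le_ofReal`, `eContDiffHolderNorm_le_of_norm_iteratedFDeriv_le`).

## References

* L. C. Evans, *Partial Differential Equations*, 2nd ed., GSM 19 (AMS 2010), App. C.4, Thm. 7 (i)
  (`D^α(η_ε ⋆ f) = D^α η_ε ⋆ f`, `|D^α η_ε| ≤ C ε^{-n-|α|}`).
* T. Buckmaster, C. De Lellis, L. Székelyhidi Jr., V. Vicol, *Onsager's conjecture for admissible
  weak solutions*, Comm. Pure Appl. Math. 72 (2019) = arXiv:1701.08678, proof of Prop. 2.2 and
  App. A (Hölder norms, the interpolation inequality (A.3)).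
-/

noncomputable section

open MeasureTheory TopologicalSpace Set Function Filter Metric ContinuousLinearMap
open scoped ENNReal NNReal Convolution ContDiff Topology

namespace Literature.Analysis.FunctionSpaces

namespace Torus

variable {d : Type*} [Fintype d]
variable {F : Type*} [NormedAddCommGroup F] [NormedSpace ℝ F]

/-! ## Iterated derivatives of functions on the torus -/

section ItDeriv

/-- The `n`-th (Fréchet) derivative of `f : T^d → F` at `x`, as a continuous `n`-multilinear map on
`ℝ^d = T_x T^d`: the `n`-th derivative at `0` of the re-centred lift `v ↦ f (x + proj v)`
(consistent with `Torus.fderiv f x = D(liftAt f x)(0)`); its periodic lift is `D^n (lift f)`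
(`Torus.iteratedFDeriv_lift`). Named `itDeriv` (not `iteratedFDeriv`) so as not to shadow
Mathlib's `iteratedFDeriv` inside `namespace Torus`. [folklore] -/
def itDeriv (n : ℕ) (f : UnitAddTorus d → F) (x : UnitAddTorus d) :
    ContinuousMultilinearMap ℝ (fun _ : Fin n => EuclideanSpace ℝ d) F :=
  iteratedFDeriv ℝ n (liftAt f x) 0

/-- `D^n (lift f) y = itDeriv n f (proj y)`: the iterated derivatives of the periodic lift are
the lifts of the torus derivatives. [folklore] -/
theorem iteratedFDeriv_lift_apply (n : ℕ) (f : UnitAddTorus d → F) (y : EuclideanSpace ℝ d) :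
    iteratedFDeriv ℝ n (lift f) y = itDeriv n f (proj y) := by
  rw [iteratedFDeriv_lift]
  rfl

/-- `lift (itDeriv n f) = D^n (lift f)`. [folklore] -/
theorem lift_itDeriv (n : ℕ) (f : UnitAddTorus d → F) :
    lift (itDeriv n f) = iteratedFDeriv ℝ n (lift f) :=
  funext fun y => (iteratedFDeriv_lift_apply n f y).symm

/-- The torus derivatives of a smooth function are continuous. [folklore] -/
theorem IsSmooth.continuous_itDeriv {f : UnitAddTorus d → F} (hf : IsSmooth f) (n : ℕ) :
    Continuous (itDeriv n f) :=
  hf.continuous_iteratedFDeriv_liftAt n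

/-- The torus derivatives of a smooth function are smooth. [folklore] -/
theorem IsSmooth.itDeriv {f : UnitAddTorus d → F} (hf : IsSmooth f) (n : ℕ) :
    IsSmooth (itDeriv n f) := by
  unfold IsSmooth
  rw [lift_itDeriv]
  exact hf.iteratedFDeriv_right (m := ∞) (by exact_mod_cast le_top)

/-- `‖itDeriv 0 f x‖ = ‖f x‖`. [folklore] -/
theorem norm_itDeriv_zero (f : UnitAddTorus d → F) (x : UnitAddTorus d) :
    ‖itDeriv 0 f x‖ = ‖f x‖ := by
  rw [itDeriv, norm_iteratedFDeriv_zero, liftAt_apply_zero]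

/-- The torus derivative of a smooth function is smooth: `IsSmooth (Torus.fderiv k)`. [folklore] -/
theorem IsSmooth.torusFderiv {k : UnitAddTorus d → F} (hk : IsSmooth k) : IsSmooth (Torus.fderiv k) := by
  unfold IsSmooth
  rw [lift_torusFderiv]
  exact hk.fderiv_right (m := ∞) (by exact_mod_cast le_top)

/-- `‖Torus.fderiv f x‖ = ‖itDeriv 1 f x‖`. [folklore] -/
theorem norm_torusFderiv_eq_norm_itDeriv_one (f : UnitAddTorus d → F) (x : UnitAddTorus d) :
    ‖Torus.fderiv f x‖ = ‖itDeriv 1 f x‖ := by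
  obtain ⟨y, rfl⟩ := proj_surjective x
  rw [← fderiv_lift, ← iteratedFDeriv_lift_apply, ← norm_iteratedFDeriv_fderiv,
    norm_iteratedFDeriv_zero]

/-- Directional derivatives cost one derivative: `‖itDeriv n (∂_v ψ) z‖ ≤ ‖v‖ ‖itDeriv (n+1) ψ z‖`
for smooth `ψ`. [folklore] -/
theorem norm_itDeriv_lineDeriv_le {ψ : UnitAddTorus d → F} (hψ : IsSmooth ψ) (n : ℕ)
    (v : EuclideanSpace ℝ d) (z : UnitAddTorus d) :
    ‖itDeriv n (fun x => lineDeriv ψ x v) z‖ ≤ ‖v‖ * ‖itDeriv (n + 1) ψ z‖ := by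
  obtain ⟨y, rfl⟩ := proj_surjective z
  rw [← iteratedFDeriv_lift_apply, ← iteratedFDeriv_lift_apply,
    lift_lineDeriv (hψ.isContDiff (by simp)) v, ← norm_iteratedFDeriv_fderiv]
  exact norm_iteratedFDeriv_clm_apply_const ((hψ.fderiv_right (m := ∞) le_rfl).contDiffAt)
    (by exact_mod_cast le_top)

/-- `‖itDeriv (n+1) f z‖ = ‖itDeriv n (Torus.fderiv f) z‖`. [folklore] -/
theorem norm_itDeriv_succ_eq_norm_itDeriv_torusFderiv (n : ℕ) (f : UnitAddTorus d → F)
    (z : UnitAddTorus d) : ‖itDeriv (n + 1) f z‖ = ‖itDeriv n (Torus.fderiv f) z‖ := by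
  obtain ⟨y, rfl⟩ := proj_surjective z
  rw [← iteratedFDeriv_lift_apply, ← iteratedFDeriv_lift_apply, lift_torusFderiv,
    norm_iteratedFDeriv_fderiv]

end ItDeriv

/-! ## Moving a derivative from the smooth factor onto the kernel -/

section MoveDeriv

/-- **Integration by parts inside a mollification**, directional and vector-valued form: for a
smooth real kernel `ψ` and a smooth `k : T^d → F`, `ψ ⋆ ∂_v k = (∂_v ψ) ⋆ k`
(`∂_v[k(x - ·)] = -(∂_v k)(x - ·)` and `∫ ∂_v (ψ • k(x - ·)) = 0` on `T^d`;
Evans, App. C.4, Thm. 7 (i): `D^α(η_ε ⋆ f) = D^α η_ε ⋆ f = η_ε ⋆ D^α f`). [folklore] -/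
theorem convolution_lineDeriv_right {ψ : UnitAddTorus d → ℝ} (hψ : IsSmooth ψ)
    {k : UnitAddTorus d → F} (hk : IsSmooth k) (v : EuclideanSpace ℝ d) (x : UnitAddTorus d) :
    (ψ ⋆ fun z => lineDeriv k z v) x = ((fun z => lineDeriv ψ z v) ⋆ k) x := by
  have hψ1 : IsContDiff 1 ψ := hψ.isContDiff (by simp)
  have hk1 : IsContDiff 1 k := hk.isContDiff (by simp)
  have hkx : IsSmooth fun y => k (x - y) := hk.comp_sub_left x
  have hkx1 : IsContDiff 1 fun y => k (x - y) := hkx.isContDiff (by simp)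
  -- `∫ ∂_v (ψ • k(x - ·)) = 0`
  have h0 := integral_lineDeriv_eq_zero (hψ.smul' hkx) v
  have hprod : ∀ y, lineDeriv (fun y => ψ y • k (x - y)) y v =
      ψ y • (-lineDeriv k (x - y) v) + lineDeriv ψ y v • k (x - y) := by
    intro y
    have hs : IsContDiff 1 (fun y => ψ y • k (x - y)) := (hψ.smul' hkx).isContDiff (by simp)
    rw [lineDeriv_eq_fderiv_apply hs, lineDeriv_eq_fderiv_apply hψ1, lineDeriv_eq_fderiv_apply hk1,
      show (fun y => ψ y • k (x - y)) = fun y => ψ y • (fun y => k (x - y)) y from rfl,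
      fderiv_smul_apply hψ1 hkx1, fderiv_comp_sub_left k x y, neg_apply]
  simp_rw [hprod] at h0
  have hc1 : Continuous fun y => ψ y • (-lineDeriv k (x - y) v) :=
    hψ.continuous.smul ((hk.lineDeriv v).continuous.comp (continuous_const.sub continuous_id)).neg
  have hc2 : Continuous fun y => lineDeriv ψ y v • k (x - y) :=
    (hψ.lineDeriv v).continuous.smul (hk.continuous.comp (continuous_const.sub continuous_id))
  rw [integral_add hc1.integrable_unitAddTorus hc2.integrable_unitAddTorus] at h0
  rw [show (fun y => ψ y • (-lineDeriv k (x - y) v)) = fun y => -(ψ y • lineDeriv k (x - y) v) from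
    funext fun y => smul_neg _ _, integral_neg, neg_add_eq_sub, sub_eq_zero] at h0
  rw [convolution_lsmul, convolution_lsmul]
  exact h0.symm

end MoveDeriv

/-! ## All derivatives of a mollification, with the derivatives on the kernel -/

section AllOrders

/-- **Derivatives of all orders of a mollification fall on the kernel**, as a pointwise bound:
for a smooth real kernel `ψ` and smooth `k : T^d → F`,
`‖D^N (lift (ψ ⋆ k))(x)‖ ≤ ∫ ‖D^N ψ (proj x - y)‖ ‖k(y)‖ dy` (Evans, App. C.4, Thm. 7 (i):
`D^α(η_ε ⋆ f) = (D^α η_ε) ⋆ f`; proved by induction on `N`, each step moving one directional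
derivative from `k` onto `ψ` by `convolution_lineDeriv_right`). [folklore] -/
theorem norm_iteratedFDeriv_lift_convolution_le {k : UnitAddTorus d → F} (hk : IsSmooth k) :
    ∀ (N : ℕ) {ψ : UnitAddTorus d → ℝ}, IsSmooth ψ → ∀ x : EuclideanSpace ℝ d,
      ‖iteratedFDeriv ℝ N (lift (ψ ⋆ k)) x‖ ≤ ∫ y, ‖itDeriv N ψ (proj x - y)‖ * ‖k y‖
  | 0, ψ, hψ, x => by
    rw [norm_iteratedFDeriv_zero, lift_apply, convolution_lsmul_swap]
    refine (norm_integral_le_integral_norm _).trans (le_of_eq ?_)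
    refine integral_congr_ae (Eventually.of_forall fun y => ?_)
    simp only [norm_smul, norm_itDeriv_zero]
  | N + 1, ψ, hψ, x => by
    have hψk : IsSmooth (ψ ⋆ k) := isSmooth_convolution hψ.integrable hk
    have hk1 : IsContDiff 1 k := hk.isContDiff (by simp)
    -- the integral on the right is nonnegative
    have hI : 0 ≤ ∫ y, ‖itDeriv (N + 1) ψ (proj x - y)‖ * ‖k y‖ :=
      integral_nonneg fun y => mul_nonneg (norm_nonneg _) (norm_nonneg _)
    refine ContinuousMultilinearMap.opNorm_le_bound hI fun m => ?_
    rw [iteratedFDeriv_succ_apply_right]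
    set v : EuclideanSpace ℝ d := m (Fin.last N) with hv
    -- `D(lift (ψ ⋆ k)) = lift (ψ ⋆ Dk)`
    have hD : (fun y => _root_.fderiv ℝ (lift (ψ ⋆ k)) y) = lift (ψ ⋆ Torus.fderiv k) :=
      fderiv_lift_convolution hψ.integrable hk1
    have hDs : ContDiff ℝ ∞ (lift (ψ ⋆ Torus.fderiv k)) :=
      isSmooth_convolution hψ.integrable hk.torusFderiv
    rw [hD, ← iteratedFDeriv_clm_apply_const_apply hDs (by exact_mod_cast le_top)]
    -- `y ↦ lift (ψ ⋆ Dk) y v = lift ((∂_v ψ) ⋆ k)`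
    have hswap : (fun y => lift (ψ ⋆ Torus.fderiv k) y v) = lift ((fun z => lineDeriv ψ z v) ⋆ k) := by
      funext y
      rw [lift_apply, lift_apply, convolution_clm_apply hψ.integrable hk1.continuous_fderiv,
        ← convolution_lineDeriv_right hψ hk v]
      simp_rw [lineDeriv_eq_fderiv_apply hk1]
    rw [hswap]
    have IH := norm_iteratedFDeriv_lift_convolution_le hk N (hψ.lineDeriv v) x
    -- pointwise comparison of the kernels
    have hmono : ∫ y, ‖itDeriv N (fun z => lineDeriv ψ z v) (proj x - y)‖ * ‖k y‖ ≤
        ∫ y, ‖v‖ * (‖itDeriv (N + 1) ψ (proj x - y)‖ * ‖k y‖) := by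
      refine integral_mono ?_ ?_ fun y => ?_
      · exact ((((hψ.lineDeriv v).continuous_itDeriv N).comp
          (continuous_const.sub continuous_id)).norm.mul hk.continuous.norm).integrable_unitAddTorus
      · exact ((((hψ.continuous_itDeriv (N + 1)).comp
          (continuous_const.sub continuous_id)).norm.mul hk.continuous.norm).const_mul _
          |>.integrable_unitAddTorus)
      · simp only
        rw [← mul_assoc]
        exact mul_le_mul_of_nonneg_right (norm_itDeriv_lineDeriv_le hψ N v _) (norm_nonneg _)
    rw [integral_const_mul] at hmono
    calc ‖iteratedFDeriv ℝ N (lift ((fun z => lineDeriv ψ z v) ⋆ k)) x (Fin.init m)‖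
        ≤ ‖iteratedFDeriv ℝ N (lift ((fun z => lineDeriv ψ z v) ⋆ k)) x‖ * ∏ i, ‖Fin.init m i‖ :=
          ContinuousMultilinearMap.le_opNorm _ _
      _ ≤ (‖v‖ * ∫ y, ‖itDeriv (N + 1) ψ (proj x - y)‖ * ‖k y‖) * ∏ i, ‖Fin.init m i‖ :=
          mul_le_mul_of_nonneg_right (IH.trans hmono) (Finset.prod_nonneg fun i _ => norm_nonneg _)
      _ = (∫ y, ‖itDeriv (N + 1) ψ (proj x - y)‖ * ‖k y‖) * ∏ i, ‖m i‖ := by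
          rw [Fin.prod_univ_castSucc, hv]
          simp only [Fin.init]
          ring

end AllOrders

/-! ## The derivatives of the standard mollifier: `∫ ‖D^N k_ε‖ = c_N ε^{-N}` -/

section KernelDerivs

variable (d) in
/-- The constants `c_N = ∫_{ℝ^d} ‖D^N ρ₁‖` (mass of the `N`-th derivative of the fixed unit-mass
profile `ρ₁ = Torus.profileOne d`), which control `ε^N ∫ ‖D^N ρ_ε‖ = c_N` for the rescaled
profiles (Evans, App. C.4: `|D^α η_ε| ≤ C ε^{-n-|α|}`). [folklore] -/
def derivProfileMass (N : ℕ) : ℝ := ∫ v, ‖iteratedFDeriv ℝ N (profileOne d) v‖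

/-- `c_N ≥ 0`. [folklore] -/
theorem derivProfileMass_nonneg (N : ℕ) : 0 ≤ derivProfileMass d N :=
  integral_nonneg fun _ => norm_nonneg _

/-- `c_0 = ∫ ρ₁ = 1` (unit mass, `ρ₁ ≥ 0`). [folklore] -/
theorem derivProfileMass_zero : derivProfileMass d 0 = 1 := by
  unfold derivProfileMass
  simp_rw [norm_iteratedFDeriv_zero, Real.norm_eq_abs, abs_of_nonneg (profileOne_nonneg _)]
  exact integral_profileOne

/-- `c_1 = C₁`: the first constant is the `gradProfileMass` of `TorusMollifier`
(`‖D¹ρ₁‖ = ‖Dρ₁‖`), so that `integral_norm_itDeriv_kernel` at `N = 1` is the first-order estimate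
`Torus.integral_norm_gradient_kernel`. [folklore] -/
theorem derivProfileMass_one : derivProfileMass d 1 = gradProfileMass d := by
  unfold derivProfileMass gradProfileMass
  congr 1
  funext v
  rw [← norm_iteratedFDeriv_fderiv, norm_iteratedFDeriv_zero]

variable {ε : ℝ}

/-- The derivatives of the rescaled profile: `D^N ρ_ε (v) = ε^{-d} ε^{-N} D^N ρ₁ (v/ε) ∘ (scaling)`,
precisely `D^N ρ_ε (v) = (ε^{-d} ε^{-N}) • D^N ρ₁ (ε⁻¹ v)` as multilinear maps after Mathlib's
`iteratedFDeriv_comp_const_smul`. [folklore] -/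
theorem iteratedFDeriv_profile (ε : ℝ) (N : ℕ) (v : EuclideanSpace ℝ d) :
    iteratedFDeriv ℝ N (profile ε) v =
      ((ε ^ Fintype.card d)⁻¹ * ε⁻¹ ^ N) • iteratedFDeriv ℝ N (profileOne d) (ε⁻¹ • v) := by
  have h1 : profile (d := d) ε = (ε ^ Fintype.card d)⁻¹ • fun v => profileOne d (ε⁻¹ • v) := by
    funext v
    simp [profile]
  have hc : ContDiff ℝ N (fun v : EuclideanSpace ℝ d => profileOne d (ε⁻¹ • v)) :=
    (contDiff_profileOne.comp (contDiff_const_smul _)).of_le (by exact_mod_cast le_top)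
  rw [h1, iteratedFDeriv_const_smul_apply hc.contDiffAt,
    iteratedFDeriv_comp_const_smul ε⁻¹ (contDiff_profileOne.of_le (by exact_mod_cast le_top))]
  simp only [mul_smul]

/-- `‖D^N ρ_ε (v)‖ = ε^{-d} ε^{-N} ‖D^N ρ₁ (v/ε)‖` for `0 < ε`. [folklore] -/
theorem norm_iteratedFDeriv_profile (hε : 0 < ε) (N : ℕ) (v : EuclideanSpace ℝ d) :
    ‖iteratedFDeriv ℝ N (profile ε) v‖ =
      (ε ^ Fintype.card d)⁻¹ * (ε ^ N)⁻¹ * ‖iteratedFDeriv ℝ N (profileOne d) (ε⁻¹ • v)‖ := by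
  rw [iteratedFDeriv_profile, norm_smul, Real.norm_eq_abs, abs_of_pos (by positivity), inv_pow]

/-- **`ε^N ∫ ‖D^N ρ_ε‖ = c_N`**: `∫_{ℝ^d} ‖D^N ρ_ε‖ = ε^{-N} c_N` for `0 < ε` (change of variables
`v = ε w`; Evans, App. C.4). [folklore] -/
theorem integral_norm_iteratedFDeriv_profile (hε : 0 < ε) (N : ℕ) :
    ∫ v, ‖iteratedFDeriv ℝ N (profile (d := d) ε) v‖ = (ε ^ N)⁻¹ * derivProfileMass d N := by
  simp_rw [norm_iteratedFDeriv_profile hε, mul_assoc]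
  have h := Measure.integral_comp_inv_smul volume
    (fun w => ‖iteratedFDeriv ℝ N (profileOne d) w‖) ε
  rw [finrank_euclideanSpace, abs_of_pos (pow_pos hε _), smul_eq_mul] at h
  rw [MeasureTheory.integral_const_mul, MeasureTheory.integral_const_mul, h, derivProfileMass]
  field_simp

/-- The support of `D^N ρ_ε` lies in `closedBall 0 ε` (`0 < ε`). [folklore] -/
theorem support_iteratedFDeriv_profile_subset (hε : 0 < ε) (N : ℕ) :
    support (iteratedFDeriv ℝ N (profile (d := d) ε)) ⊆ closedBall 0 ε :=
  (support_iteratedFDeriv_subset N).trans (tsupport_profile_subset hε)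

/-- `D^N ρ_ε (v) = 0` for `ε < ‖v‖` (`0 < ε`). [folklore] -/
theorem iteratedFDeriv_profile_eq_zero (hε : 0 < ε) (N : ℕ) {v : EuclideanSpace ℝ d}
    (hv : ε < ‖v‖) : iteratedFDeriv ℝ N (profile ε) v = 0 := by
  by_contra h
  have := support_iteratedFDeriv_profile_subset hε N (mem_support.2 h)
  rw [mem_closedBall_zero_iff] at this
  exact this.not_gt hv

/-- The torus derivatives of the torus kernel are the derivatives of the profile at the centred
representative: `itDeriv N (kernel ε) z = D^N ρ_ε (reprc z)` (`0 < ε ≤ 1/4`; locally the lift of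
the kernel *is* the profile). [folklore] -/
theorem itDeriv_kernel (hε : 0 < ε) (hε' : ε ≤ 1 / 4) (N : ℕ) (z : UnitAddTorus d) :
    itDeriv N (kernel ε) z = iteratedFDeriv ℝ N (profile ε) (reprc z) := by
  have h := iteratedFDeriv_lift_apply N (kernel (d := d) ε) (reprc z)
  rw [proj_reprc] at h
  rw [← h]
  exact ((lift_transplant_eventuallyEq (support_profile_subset_quarter hε hε') z).iteratedFDeriv ℝ
    N).eq_of_nhds

/-- The torus derivatives of the kernel vanish off `{‖reprc z‖ ≤ ε}` (`0 < ε ≤ 1/4`). [folklore] -/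
theorem itDeriv_kernel_eq_zero (hε : 0 < ε) (hε' : ε ≤ 1 / 4) (N : ℕ) {z : UnitAddTorus d}
    (hz : ε < ‖reprc z‖) : itDeriv N (kernel ε) z = 0 := by
  rw [itDeriv_kernel hε hε', iteratedFDeriv_profile_eq_zero hε N hz]

/-- Where a torus derivative of the kernel is nonzero, `‖reprc z‖ ≤ ε` (`0 < ε ≤ 1/4`). [folklore] -/
theorem norm_reprc_le_of_itDeriv_kernel_ne_zero (hε : 0 < ε) (hε' : ε ≤ 1 / 4) (N : ℕ)
    {z : UnitAddTorus d} (hz : itDeriv N (kernel ε) z ≠ 0) : ‖reprc z‖ ≤ ε :=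
  not_lt.1 fun h => hz (itDeriv_kernel_eq_zero hε hε' N h)

/-- **`ε^N ∫_{T^d} ‖D^N k_ε‖ = c_N`**: `∫_{T^d} ‖itDeriv N (kernel ε)‖ = ε^{-N} c_N`
(`0 < ε ≤ 1/4`; the torus integral is the integral of `‖D^N ρ_ε‖` over `ℝ^d`). [folklore] -/
theorem integral_norm_itDeriv_kernel (hε : 0 < ε) (hε' : ε ≤ 1 / 4) (N : ℕ) :
    ∫ z, ‖itDeriv N (kernel (d := d) ε) z‖ = (ε ^ N)⁻¹ * derivProfileMass d N := by
  simp_rw [itDeriv_kernel hε hε']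
  rw [integral_comp_reprc_of_support_subset
    (g := fun v => ‖iteratedFDeriv ℝ N (profile (d := d) ε) v‖), integral_norm_iteratedFDeriv_profile hε]
  intro v hv
  have h : iteratedFDeriv ℝ N (profile (d := d) ε) v ≠ 0 := fun h => hv (by simp [h])
  have := support_iteratedFDeriv_profile_subset hε N (mem_support.2 h)
  rw [mem_closedBall_zero_iff] at this
  exact mem_ball_zero_iff.2 (by linarith)

/-- The torus derivatives of the kernel are continuous (`0 < ε ≤ 1/4`). [folklore] -/
theorem continuous_itDeriv_kernel (hε : 0 < ε) (hε' : ε ≤ 1 / 4) (N : ℕ) :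
    Continuous (itDeriv N (kernel (d := d) ε)) :=
  (isSmooth_kernel hε hε').continuous_itDeriv N

end KernelDerivs

/-! ## Sup bounds for all derivatives of a mollification by the standard kernel -/

section SupBounds

variable {ε : ℝ}

/-- **All derivatives of a mollification, local form**: for smooth `k : T^d → F`, `0 < ε ≤ 1/4`
and `x ∈ ℝ^d`, if `‖k(proj x - z)‖ ≤ A` whenever `‖reprc z‖ ≤ ε` (i.e. on the `ε`-ball around
`proj x`), then `‖D^N (lift (k_ε ⋆ k))(x)‖ ≤ c_N ε^{-N} A` (Evans, App. C.4, Thm. 7 (i) with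
`|D^α η_ε| ≤ C ε^{-n-|α|}`). [folklore] -/
theorem norm_iteratedFDeriv_lift_kernel_convolution_le (hε : 0 < ε) (hε' : ε ≤ 1 / 4)
    {k : UnitAddTorus d → F} (hk : IsSmooth k) (N : ℕ) (x : EuclideanSpace ℝ d) {A : ℝ}
    (hA : ∀ z : UnitAddTorus d, ‖reprc z‖ ≤ ε → ‖k (proj x - z)‖ ≤ A) :
    ‖iteratedFDeriv ℝ N (lift (kernel ε ⋆ k)) x‖ ≤ derivProfileMass d N * (ε ^ N)⁻¹ * A := by
  have hκ := isSmooth_kernel (d := d) hε hε'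
  have hA0 : 0 ≤ A := by
    have h := hA 0 (by
      rw [show (0 : UnitAddTorus d) = proj 0 from proj_zero.symm, reprc_proj_of_norm_lt (by simp)]
      simpa using hε.le)
    exact (norm_nonneg _).trans h
  refine (norm_iteratedFDeriv_lift_convolution_le hk N hκ x).trans ?_
  -- substitute `y = proj x - z`
  have hsub : ∫ y, ‖itDeriv N (kernel (d := d) ε) (proj x - y)‖ * ‖k y‖ =
      ∫ z, ‖itDeriv N (kernel (d := d) ε) z‖ * ‖k (proj x - z)‖ := by
    rw [← integral_sub_left_eq_self
      (fun z : UnitAddTorus d => ‖itDeriv N (kernel ε) z‖ * ‖k (proj x - z)‖) volume (proj x)]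
    simp only [sub_sub_cancel]
  rw [hsub]
  have hpt : ∀ z : UnitAddTorus d,
      ‖itDeriv N (kernel ε) z‖ * ‖k (proj x - z)‖ ≤ ‖itDeriv N (kernel ε) z‖ * A := by
    intro z
    by_cases hz : itDeriv N (kernel ε) z = 0
    · simp [hz]
    · exact mul_le_mul_of_nonneg_left (hA z (norm_reprc_le_of_itDeriv_kernel_ne_zero hε hε' N hz))
        (norm_nonneg _)
  calc ∫ z, ‖itDeriv N (kernel (d := d) ε) z‖ * ‖k (proj x - z)‖
      ≤ ∫ z, ‖itDeriv N (kernel (d := d) ε) z‖ * A :=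
        integral_mono (((continuous_itDeriv_kernel hε hε' N).norm.mul
          (hk.continuous.comp (continuous_const.sub continuous_id)).norm).integrable_unitAddTorus)
          ((continuous_itDeriv_kernel hε hε' N).norm.integrable_unitAddTorus.mul_const A) hpt
    _ = derivProfileMass d N * (ε ^ N)⁻¹ * A := by
        rw [integral_mul_const, integral_norm_itDeriv_kernel hε hε']
        ring

/-- **All derivatives of a mollification, global form**: `‖D^N (lift (k_ε ⋆ k))‖_∞ ≤ c_N ε^{-N} ‖k‖_∞`
(Evans, App. C.4, Thm. 7 (i)). [folklore] -/
theorem norm_iteratedFDeriv_lift_kernel_convolution_le_of_forall_le (hε : 0 < ε) (hε' : ε ≤ 1 / 4)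
    {k : UnitAddTorus d → F} (hk : IsSmooth k) (N : ℕ) (x : EuclideanSpace ℝ d) {A : ℝ}
    (hA : ∀ y, ‖k y‖ ≤ A) :
    ‖iteratedFDeriv ℝ N (lift (kernel ε ⋆ k)) x‖ ≤ derivProfileMass d N * (ε ^ N)⁻¹ * A :=
  norm_iteratedFDeriv_lift_kernel_convolution_le hε hε' hk N x fun _ _ => hA _

/-- **One derivative on the function, the rest on the kernel**:
`‖D^{N+1} (lift (k_ε ⋆ k))‖_∞ ≤ c_N ε^{-N} ‖Dk‖_∞` (`D(k_ε ⋆ k) = k_ε ⋆ Dk`, then the global form;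
this is the estimate `‖f ⋆ ψ_ℓ‖_{N+1} ≲ ℓ^{-N} ‖f‖_1` of Buckmaster–De Lellis–Székelyhidi–Vicol,
proof of Prop. 2.2). [folklore] -/
theorem norm_iteratedFDeriv_succ_lift_kernel_convolution_le (hε : 0 < ε) (hε' : ε ≤ 1 / 4)
    {k : UnitAddTorus d → F} (hk : IsSmooth k) (N : ℕ) (x : EuclideanSpace ℝ d) {A : ℝ}
    (hA : ∀ y, ‖Torus.fderiv k y‖ ≤ A) :
    ‖iteratedFDeriv ℝ (N + 1) (lift (kernel ε ⋆ k)) x‖ ≤ derivProfileMass d N * (ε ^ N)⁻¹ * A := by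
  rw [← norm_iteratedFDeriv_fderiv,
    fderiv_lift_convolution (isSmooth_kernel hε hε').integrable (hk.isContDiff (by simp))]
  exact norm_iteratedFDeriv_lift_kernel_convolution_le_of_forall_le hε hε' hk.torusFderiv N x hA

/-- The sup norm is preserved: `‖(k_ε ⋆ k)(z)‖ ≤ ‖k‖_∞` (unit mass, `k_ε ≥ 0`). [folklore] -/
theorem norm_kernel_convolution_le (hε : 0 < ε) (hε' : ε ≤ 1 / 4) {k : UnitAddTorus d → F}
    {A : ℝ} (hA : ∀ y, ‖k y‖ ≤ A) (z : UnitAddTorus d) : ‖(kernel ε ⋆ k) z‖ ≤ A := by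
  have h := norm_convolution_le (isSmooth_kernel (d := d) hε hε').integrable hA z
  have h1 : ∫ y, ‖kernel (d := d) ε y‖ = 1 :=
    (integral_congr_ae (Eventually.of_forall fun y => by
      simp [Real.norm_eq_abs, abs_of_nonneg (kernel_nonneg hε.le y)])).trans
      (integral_kernel (d := d) hε hε')
  rwa [h1, mul_one] at h

end SupBounds


end Torus

end Literature.Analysis.FunctionSpaces
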